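import Summits.QuantumFields.BalabanUV.T4Continuum.Spine.NE5.TwoRunTorusNE5Uniform
import Summits.QuantumFields.BalabanUV.T4Continuum.Spine.NE5.TwoRunTorusNE5Sizes

/-!
# Spine/NE5/TwoRunTorusNE5Sized — the minimal END of row NE5 in the producer's order WITH THE PACKAGE SIZES EXPORTED
# (cell `pub-balaban-gaps`, seat `ne5` gen 14; located point (x17) closed on the NE5 side)

WHY.  T45 `TwoRunTorusNE5Uniform.ne5_end_uniform` exports the per-scale packages `w j` by an `∃` with only LOWER bounds on
their two sizes (`α j < (w j).R`, `R_σ0 ≤ (w j).Rσ`): the configuration radius on which the producer's walk expansions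
must be analytic and the σ-distance its bond locations must keep.  A producer meets `TermWalkData (𝒦 …) (w j)` only up to
ITS sizes (T42: pencil records reach radius `min(R, s₀∕r_j)`; the σ-distance is the geometric `⅔M`, [II] p. 13), so with
the sizes hidden the END's hypothesis is not verifiable — located point (x17).  `TwoRunTorusNE5Sizes` (T46) makes the
sizes explicit (`α j = max 2 (s∕θ^j)`, `R_j = α j·C_R`, `R_σ = max R_σ0 C_σ`, with `C_R`, `C_σ` depending on the letters only).
THIS FILE, `ne5_end_sized`: T45 with the sizes exported — `∃ c ∀ (ν, Nf, letters) ∃ (C_R, C_σ, γ₂, a₂₀, w₀) ∀ (θ, s,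
R_σ0, M) ∃ (w, α, r_P), sizes ∧ T43's ∀-part VERBATIM → NE5 … ((1−10δ)½Lκ) θ (2A₂C₃ε₁∕s)`.

HONEST FRAMING.  Quantifier bookkeeping over landed shapes; nothing of Bałaban's is constructed or asserted beyond print.
NE5 NOT PRINTED ∕ NOT PROVED; leaves 0∕12; (D4) 0∕1; spine 0∕9.  Rung (B)+1 on a FIXED finite T⁴ — NOT continuum, NOT
infinite volume, NOT mass gap, NOT Clay.  HONEST DEPENDENCY: continuum YM on T⁴ ⇐ BetaPertH ∧ nine spine estimates;
BetaPertH ⇐ (D1) ∧ (D4) ∧ CAP+tail.  0 sorry, 0 `def`.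

Sources: [II] = T. Bałaban, CMP **116** (1988) [Balaban1988RG2Cluster] p. 13, p. 15, (2.13)–(2.26) pp. 14–17, (2.18) p. 16,
(2.31) p. 18, (2.38) p. 20, p. 21; [I] = CMP **109** (1987) [Balaban1987RG1] (0.24)–(0.25) p. 257; [B9] = CMP **99** (1985)
[Balaban1985BackgroundPropagators] Thm 3.7 p. 409, Thm 3.10 (3.107)–(3.108) p. 416.  Nothing here is a claim about the
Yang–Mills mass gap.
-/

noncomputable section

namespace Summit.QuantumFields.BalabanUV.T4Continuum.Spine.NE5.TwoRunTorusNE5Sized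

open Matrix Metric Set Finset
open Literature.MathematicalPhysics.QuantumFieldTheory.Balaban1983to89
open Literature.MathematicalPhysics.QuantumFieldTheory.Balaban1983to89.T4OutputRate (NE5)
open Literature.MathematicalPhysics.QuantumFieldTheory.Balaban1983to89.TreeLengthTorus (TPt TDom tsys)
open Literature.MathematicalPhysics.QuantumFieldTheory.Balaban1983to89.TreeLengthTorusGeometry (TTouch)
open Literature.MathematicalPhysics.QuantumFieldTheory.Balaban1983to89.TreeLengthTorusTransfer (tclosure)
open Literature.MathematicalPhysics.QuantumFieldTheory.Balaban1983to89.B13Lemma3TorusData (TBond)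
open Literature.MathematicalPhysics.QuantumFieldTheory.Balaban1983to89.B13Lemma3Torus (TwoTorusStep)
open Literature.MathematicalPhysics.QuantumFieldTheory.Balaban1983to89.B13Lemma3TorusTerms (terms weight Z0)
open Literature.MathematicalPhysics.QuantumFieldTheory.Balaban1983to89.B13Term214 (core214 F214 term214)
open Literature.MathematicalPhysics.QuantumFieldTheory.Balaban1983to89.B13Bound143 (invTau)
open Literature.MathematicalPhysics.QuantumFieldTheory.Balaban1983to89.B5TorusCover (UT)
open Literature.MathematicalPhysics.QuantumFieldTheory.Balaban1983to89.B12TreeDecay (kappa₀ K₀)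
open Literature.MathematicalPhysics.QuantumFieldTheory.Balaban1983to89.B13Resummation (locE)
open Literature.MathematicalPhysics.QuantumFieldTheory.Balaban1983to89.B13TermWalkData
  (WalkConsts TermKernels TermWalkData)
open Summit.QuantumFields.BalabanUV.T4Continuum.Spine.NE5.TwoRunTorusNE5Records (ne5_of_records_symm_all_scales)
open Summit.QuantumFields.BalabanUV.T4Continuum.Spine.NE5.TwoRunTorusNE5Sizes (scalars_sized)
open Summit.QuantumFields.BalabanUV.T4Continuum.Spine.NE5.TwoRunTorusNE5 (torusCarriers reFunctional)
open Summit.QuantumFields.BalabanUV.T4Continuum.Spine.NE5.TwoRunTorusNE5Uniform (lemma3_witness_allM)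

open Classical in
/-- **THE END WITH THE PACKAGE SIZES EXPORTED.**  T45 `TwoRunTorusNE5Uniform.ne5_end_uniform` in the same producer's
order, with one more ∃-layer made explicit: after the constants record `c` and the producer's fibre data and O(1) letters
come TWO SIZE CONSTANTS `C_R > 2`, `C_σ` (with `γ₂, a₂₀, w₀`), depending on the letters only; then for ALL rates
`θ, s > 0`, floors `R_σ0` and bond-cube sides `M ≥ 1` the packages `w j`, sizes `α j` and `r_P` exist WITH
`α j = max 2 (s∕θ^j)`, `(w j).R = max 2 (s∕θ^j)·C_R`, `(w j).Rσ = max R_σ0 C_σ` — the configuration radius on which the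
producer's walk expansions must be analytic and the σ-distance its bond locations must keep ([B9] (3.107)–(3.108)
p. 416; [II] p. 13 «R_σ = ⅔M») are now READABLE — and T43's ∀-part holds VERBATIM, concluding
`NE5 (torus carriers) … ((1−10δ)½Lκ) θ (2A₂C₃ε₁∕s)` BY NAME.  So the junction inequality is statable: a producer with
two-run closeness `r_j` and Neumann reach `s₀` (T42: pencil records reach radius `min(R, s₀∕r_j)`) needs
`r_j·max 2 (s∕θ^j)·C_R ≤ s₀` at every scale and `⅔M ≥ max R_σ0 C_σ` — located point (x17) closed on the NE5 side.
Proof: T39 fed by `TwoRunTorusNE5Sizes.scalars_sized` and T45's `lemma3_witness_allM`.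
[cite: Balaban1987RG1, (0.24)–(0.25) p.257; Balaban1988RG2Cluster, p.13, p.15, (2.13)–(2.26) pp.14–17, (2.18) p.16, (2.31) p.18, (2.38) p.20, p.21; Balaban1985BackgroundPropagators, Thm 3.7 p.409, Thm 3.10 (3.107)–(3.108) p.416] -/
theorem ne5_end_sized :
    ∃ c : B13.Consts, 8 ≤ c.L ∧ 1 ≤ c.κ₁ ∧ (∀ d : ℝ, 0 ≤ d → 0 < invTau c d ∧ invTau c d ≤ 1 / 2) ∧
      ∀ {ν : ℕ} {Nf : ℕ → Fin ν → ℕ} [∀ j i, NeZero (Nf j i)],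
      ∀ {KΓ KE KC ε κ : ℝ}, 0 ≤ KΓ → 0 ≤ KE → 0 ≤ KC → 0 < ε → 0 < κ → ∀ (m : ℕ) {nΛ nN : ℝ}, 0 ≤ nΛ → 0 ≤ nN →
      ∃ (CR Cσ γ₂ a₂₀ w₀ : ℝ), 2 < CR ∧ 0 < γ₂ ∧ 0 ≤ a₂₀ ∧ 0 < w₀ ∧
      ∀ {θ s : ℝ}, 0 < θ → 0 < s → ∀ (Rσ₀ : ℝ) (M : ℕ) [NeZero M],
      ∃ (w : ℕ → WalkConsts) (α : ℕ → ℝ) (rP : ℝ),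
      (∀ j, (w j).Admissible (α j) Rσ₀) ∧ (∀ j, 1 < α j) ∧ (∀ j, θ ^ j < s → s / θ ^ j ≤ α j) ∧
      (∀ j, (w j).KbarΓ = KΓ ∧ (w j).KbarE = KE ∧ (w j).KbarC = KC ∧ (w j).kap = κ ∧ (w j).ε = ε) ∧
      (∀ j, α j = max 2 (s / θ ^ j)) ∧ (∀ j, (w j).R = max 2 (s / θ ^ j) * CR) ∧ (∀ j, (w j).Rσ = max Rσ₀ Cσ) ∧
      ∀ {L : ℕ} [NeZero L], c.L = L → ∀ (N : ℕ → ℕ) [∀ j, NeZero (N j)] (W : (j : ℕ) → TwoTorusStep 4 L (N j))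
        {Uτ : (j : ℕ) → TDom 4 (L * N j) → Set ℂ}, (∀ j Y, IsOpen (Uτ j Y)) →
        (∀ j, ∀ Y : TDom 4 (L * N j), closedBall (0 : ℂ) ((invTau c ((tsys 4 (L * N j)).dj Y))⁻¹) ⊆ Uτ j Y) →
        ∀ {r : ℝ}, 0 < r → r ≤ Real.exp c.κ₁ - 1 → (∀ j Y, ∀ ζ ∈ Set.uIcc (0 : ℝ) 1, closedBall (ζ : ℂ) r ⊆ Uτ j Y) →
        ∀ (lZ : (j : ℕ) → TDom 4 (N j) → Finset (TDom 4 (L * N j)) × Finset (TBond 4 M (L * N j)) → List (TPt 4 (N j))),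
        (∀ j Z t, (lZ j Z t).Nodup ∧ (lZ j Z t).toFinset = Z.1 \ tclosure L (N j) (Z0 M t)) →
        ∀ (lD : (j : ℕ) → Finset (TDom 4 (L * N j)) × Finset (TBond 4 M (L * N j)) → List (TDom 4 (L * N j))),
        (∀ j t, (lD j t).Nodup ∧ (lD j t).toFinset = t.1) →
        ∀ (𝒦 : (j : ℕ) → (Z : TDom 4 (N j)) → Finset (TDom 4 (L * N j)) × Finset (TBond 4 M (L * N j)) → (W j).Φ →
            TermKernels ({ c with κ₁ := c.κ₁ + 1 } : B13.Consts) 4 (N j) ν (Nf j) ℂ)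
          [∀ j Z t φ, Fintype (𝒦 j Z t φ).C₀] [∀ j Z t φ, DecidableEq (𝒦 j Z t φ).C₀],
        (∀ j Z, ∀ t ∈ terms L M Z, ∀ φ, φ ∈ (W j).sp2 Z → TermWalkData (𝒦 j Z t φ) (w j)) →
        ∀ (Γ : (j : ℕ) → (Z : TDom 4 (N j)) → (t : Finset (TDom 4 (L * N j)) × Finset (TBond 4 M (L * N j))) →
            (φ : (W j).Φ) → ℂ → (TPt 4 (N j) → ℂ) → ((𝒦 j Z t φ).Λ ⊕ (𝒦 j Z t φ).C₀ → ℝ) → ((𝒦 j Z t φ).Λ → ℂ)),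
        (∀ j Z, ∀ t ∈ terms L M Z, ∀ φ, φ ∈ (W j).sp2 Z → ∀ b ∈ ball (0 : ℂ) (α j), ∀ σ : TPt 4 (N j) → ℂ,
          (∀ i, σ i ∈ ball (0 : ℂ) (Real.exp (c.κ₁ + 1))) →
            ∀ X : (𝒦 j Z t φ).Λ ⊕ (𝒦 j Z t φ).C₀ → ℝ, Γ j Z t φ b σ X = (𝒦 j Z t φ).G2 σ b *ᵥ fun i => (X i : ℂ)) →
        ∀ (χY₀ χcP : (j : ℕ) → (Z : TDom 4 (N j)) → (t : Finset (TDom 4 (L * N j)) × Finset (TBond 4 M (L * N j))) →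
            (φ : (W j).Φ) → ((𝒦 j Z t φ).Λ → ℝ) → ℝ),
        (∀ j Z t φ Bf, 0 ≤ χY₀ j Z t φ Bf) → (∀ j Z t φ Bf, 0 ≤ χcP j Z t φ Bf) →
        ∀ (Dfam : (j : ℕ) → TDom 4 (N j) → Finset (TDom 4 (L * N j)) × Finset (TBond 4 M (L * N j)) →
            Finset (TDom 4 (L * N j)))
          (Vk : (j : ℕ) → (Z : TDom 4 (N j)) → (t : Finset (TDom 4 (L * N j)) × Finset (TBond 4 M (L * N j))) →
            (φ : (W j).Φ) → ℂ → TDom 4 (L * N j) → ((𝒦 j Z t φ).Λ → ℝ) → ℂ),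
        (∀ j Z, ∀ t ∈ terms L M Z, ∀ φ, φ ∈ (W j).sp2 Z → ∀ b ∈ ball (0 : ℂ) (α j), ∀ i i',
          DifferentiableOn ℂ (fun σ => (𝒦 j Z t φ).A2 σ b i i') {σ | ∀ i, σ i ∈ ball (0 : ℂ) (Real.exp (c.κ₁ + 1))}) →
        (∀ j Z, ∀ t ∈ terms L M Z, ∀ φ, φ ∈ (W j).sp2 Z → ∀ b ∈ ball (0 : ℂ) (α j), ∀ i i',
          DifferentiableOn ℂ (fun σ => (𝒦 j Z t φ).G2 σ b i i') {σ | ∀ i, σ i ∈ ball (0 : ℂ) (Real.exp (c.κ₁ + 1))}) →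
        (∀ j Z, ∀ t ∈ terms L M Z, ∀ φ, φ ∈ (W j).sp2 Z → ∀ Y Bf,
          DifferentiableOn ℂ (fun b => Vk j Z t φ b Y Bf) (ball (0 : ℂ) (α j))) →
        (∀ j Z t φ, Measurable (χY₀ j Z t φ)) → (∀ j Z t φ, Measurable (χcP j Z t φ)) →
        (∀ j Z, ∀ t ∈ terms L M Z, ∀ φ, φ ∈ (W j).sp2 Z → ∀ b ∈ ball (0 : ℂ) (α j), ∀ Y,
          Measurable (Vk j Z t φ b Y)) →
        (∀ j Z, ∀ t ∈ terms L M Z, ∀ φ, φ ∈ (W j).sp2 Z → ∀ b : ℂ, ‖b‖ ≤ α j → ∀ σ : TPt 4 (N j) → ℂ,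
          (∀ i, ‖σ i‖ ≤ Real.exp (c.κ₁ + 1)) → ((𝒦 j Z t φ).A2 σ b).IsSymm) →
        ∀ {w₂₀ : ℝ} (qP : (j : ℕ) → (Z : TDom 4 (N j)) → (t : Finset (TDom 4 (L * N j)) × Finset (TBond 4 M (L * N j))) →
            (φ : (W j).Φ) → ((𝒦 j Z t φ).Λ → ℝ) → ℝ),
        (∀ j Z t φ Bf, χY₀ j Z t φ Bf * χcP j Z t φ Bf ≤
          Real.exp (-(γ₂ / 2 * rP ^ 2 * (t.2.card : ℕ)) + γ₂ / 2 * qP j Z t φ Bf)) →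
        (∀ j Z t φ Bf, qP j Z t φ Bf ≤ Bf ⬝ᵥ Bf) →
        (∀ j Z, ∀ t ∈ terms L M Z, ∀ φ, φ ∈ (W j).sp2 Z → ∀ b ∈ ball (0 : ℂ) (α j),
          ∀ τ : TDom 4 (L * N j) → ℂ, (∀ Y, τ Y ∈ Uτ j Y) →
            ∀ Bf, ∑ Y ∈ Dfam j Z t, ‖τ Y‖ * ‖Vk j Z t φ b Y Bf‖ ≤ a₂₀ / 2 * (Bf ⬝ᵥ Bf) + w₂₀) →
        (∀ j, ∀ Z : TDom 4 (N j), w₂₀ ≤ w₀ * ((Z.1).card : ℝ)) →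
        (∀ j Z t φ, (𝒦 j Z t φ).m ≤ m) →
        (∀ j Z t φ, ∀ x : UT (Nf j), (Finset.univ.filter fun i => (𝒦 j Z t φ).locN i = x).card ≤ m) →
        (∀ j Z t φ, (Fintype.card (𝒦 j Z t φ).Λ : ℝ) ≤ nΛ * ((Z.1).card : ℝ)) →
        (∀ j Z t φ, (Fintype.card ((𝒦 j Z t φ).Λ ⊕ (𝒦 j Z t φ).C₀) : ℝ) ≤ nN * ((Z.1).card : ℝ)) →
        ∀ {H : (j : ℕ) → ℂ → TDom 4 (N j) → (W j).Φ → ℂ},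
        (∀ j, ∀ b ∈ ball (0 : ℂ) (α j), ∀ (Z : TDom 4 (N j)) (φ : (W j).Φ), φ ∈ (W j).sp2 Z →
          H j b Z φ = ∑ t ∈ terms L M Z,
            term214 r (lZ j Z t) (lD j t) (core214 (fun σ => (𝒦 j Z t φ).A2 σ b) (Γ j Z t φ b)
              (F214 t.2.card (χY₀ j Z t φ) (χcP j Z t φ) (Dfam j Z t) (Vk j Z t φ b))) 0 0) →
        (∀ j, ∀ X Z : TDom 4 (N j), ∀ φ, Z.1 ⊆ X.1 → φ ∈ (W j).sp2 X → φ ∈ (W j).sp2 Z) →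
        ∀ {E : (j : ℕ) → ℂ → TDom 4 (N j) → (W j).Φ → ℂ},
        (∀ j, ∀ b ∈ ball (0 : ℂ) (α j), ∀ (X : TDom 4 (N j)) (φ : (W j).Φ), φ ∈ (W j).sp2 X →
          E j b X φ = locE (TTouch (d := 4) (N := N j)) (fun Z : TDom 4 (N j) => Z.1) (fun Z => H j b Z φ) X.1) →
        ∀ W' : Set (ℕ → ℝ),
        NE5 (C := torusCarriers N W) (reFunctional N W fun j => E j 0) (reFunctional N W fun j => E j 1) W'
          ((1 - 10 * c.δ) * ((c.L : ℝ) / 2) * c.κ) θ (2 * (c.A₂ * c.C3act * c.ε₁) / s) := by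
  obtain ⟨c, a₂, a₂', a₅, Aabs, Bc, hc⟩ := lemma3_witness_allM
  -- the clauses on `c` alone and `0 < a₅`, read at `M = 1`
  obtain ⟨-, hL, -, -, -, -, -, -, -, -, -, -, -, -, -, -, -, -, -, -, -, -, -, -, -, -, -,
    -, -, -, -, -, -, -, -, -, -, -, -, ha₅, hκ₁, hτ⟩ := hc 1 Nat.one_pos
  refine ⟨c, hL, hκ₁, hτ, ?_⟩
  intro ν Nf _ KΓ KE KC ε κ hKΓ hKE hKC hε hκ m nΛ nN hnΛ hnN
  -- T46 §2: the scale-free letters and the two size constants, from the O(1) letters and `a₅` alone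
  have hκa : 4 * κ / 5 < κ := by linarith
  have hκb : 3 * κ / 5 < 4 * κ / 5 := by linarith
  have h2 : 2 * κ / 5 < 3 * κ / 5 := by linarith
  have h1 : κ / 5 < 2 * κ / 5 := by linarith
  have h0 : 0 < κ / 5 := by linarith
  obtain ⟨ϑ, cE, g, γ₂, a₂₀, w₀, CR, Cσ, -, -, -, hγ₂, ha₂₀, hw₀, hCR, hαc, hsmallG, hsz⟩ :=
    scalars_sized hKΓ hKE hKC hε hκ (Nat.cast_nonneg m) ν hκa hκb h2 h1 h0 hnΛ hnN ha₅
  refine ⟨CR, Cσ, γ₂, a₂₀, w₀, hCR, hγ₂, ha₂₀, hw₀, ?_⟩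
  intro θ s hθ hs Rσ₀ M _
  obtain ⟨a, -, -, -, hα₆, hε₀, hδ, hδ7, hκc, ha, hR15, hR16, hR16', hR17, h231,
    ha₂, hκ229, hsm229, habsk, h18half, h18, ha₂', hκ229', hsm229', hR20, ha₅0, habs, hAc, hC3, hAct, hlarge,
    hsmall41, hA₂, hR22, -, -, -, -, -, -, -, -⟩ := hc M (Nat.pos_of_ne_zero (NeZero.ne M))
  obtain ⟨w, α, rP, hw, hα1, hαs, hsm, hκaw, hlett, hαeq, hReq, hRσeq, hR1, hKθ, hcEj, hgEj, hRe, hPa, hvol⟩ :=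
    hsz θ s Rσ₀ a ha
  refine ⟨w, α, rP, hw, hα1, hαs, hlett, hαeq, hReq, hRσeq, ?_⟩
  intro L _ hLc N _ W Uτ hUτ hUtau r hr hr' hsubτ lZ hlZ lD hlD 𝒦 _ _ h𝒦 Γ hlin χY₀ χcP hχ0 hχc0 Dfam Vk hAhol
    hGhol hVholb hχm hχcm hVm hAs w₂₀ qP h222 hqP h220U hw₂₀ hm hfibN hΛ hN H hH hsp E h213 W'
  -- R22: `(1 − 10δ)·½L = 1`, so the closing numerics read at `κ`
  have h22 : (1 - 10 * c.δ) * ((c.L : ℝ) / 2) = 1 := hR22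
  have hmul : (1 - 10 * c.δ) * ((c.L : ℝ) / 2) * c.κ = c.κ := by rw [h22, one_mul]
  exact ne5_of_records_symm_all_scales c hL hLc hκ₁ hα₆.ne' N W hθ hs
    (fun j Y => (hτ _ ((tsys 4 (L * N j)).dj_nonneg Y)).1) (fun j Y => (hτ _ ((tsys 4 (L * N j)).dj_nonneg Y)).2)
    hUτ hUtau hr hr' hsubτ lZ hlZ lD hlD 𝒦 hw hα1 hαs h𝒦 Γ hlin χY₀ χcP hχ0 hχc0 Dfam Vk hAhol hGhol hVholb hχm
    hχcm hVm hAs qP h222 hγ₂.le hqP ha₂₀ h220U hm hfibN hκaw hκb h2 h1 h0 hsm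
    (fun j Z t φ => hR1 j _ (Nat.cast_nonneg _) (Nat.cast_le.2 (hm j Z t φ))) hKθ hcEj hgEj hRe hαc hsmallG hPa
    (fun j Z t _ φ _ => hvol j _ _ _ _ (Nat.cast_nonneg _) (Nat.cast_nonneg _) (Nat.cast_nonneg _) (hΛ j Z t φ)
      (hN j Z t φ) (hw₂₀ j Z))
    hα₆ hε₀ hδ hδ7 hκc ha hR15 hR16 hR16' hR17 h231 ha₂ hκ229 hsm229 habsk h18half h18 ha₂' hκ229' hsm229' hR20
    ha₅0 habs hAc hC3 hH hsp h213 hAct (by rw [hmul]; exact hκc) (by rw [hmul]; exact hlarge)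
    (by rw [hmul]; exact hsmall41) hA₂ W'

end Summit.QuantumFields.BalabanUV.T4Continuum.Spine.NE5.TwoRunTorusNE5Sized

end
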